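import Mathlib

/-!
# drefute positive evidence for `stub_dupPhi` (line `shifted-family-prime-sieve`, crux stmt-KontsevichZagierPeriods-12305)

The change of variables of the p = 2 rung,
`Φ(η₀, η₁) = (η₀η₁, (1 − η₀)(1 + η₁) / (2(1 − η₀η₁)))`,
is a BIJECTION of the open box `(0,1)²` onto itself (not only of the chamber `η₀ < η₁` onto the
half-box `ξ₁ > 1/2`): `phi_mapsTo`, `phi_injOn`, `phi_surjOn`, `phi_image_box`. Hence `stub_dupPhi`
is ONE `changeOfVariablesRel` move on the whole open box (InjOn and `r'.domain = Φ '' r.domain`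
side conditions), with no chamber split. Also recorded: the level identity
`4(1−ξ₀)²ξ₁(1−ξ₁) ∘ Φ = (1−η₀²)(1−η₁²)` (`phi_level`) and `ξ₁ − 1/2 = (η₁ − η₀)/(2(1 − η₀η₁))`
(`phi_one_sub_half`); the derivative `phiDeriv η` (Jacobian matrix `jac η`) with
`hasFDerivAt_phi : HasFDerivAt phi (phiDeriv η) η` whenever `η₀η₁ ≠ 1` and
`det_phiDeriv : (phiDeriv η).det = (η₀+η₁)/(2(1−η₀η₁))`, positive on the box (`det_phiDeriv_pos`).
Together: InjOn, image, HasFDerivWithinAt and |det| data of `changeOfVariablesRel` for Φ on the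
OPEN box. Sorry-free, `import Mathlib` only.
-/

noncomputable section

open Set

namespace Drefute.Phi

/-- The tanh-addition map `Φ` of card `shifted-family-prime-sieve`. -/
def phi (η : Fin 2 → ℝ) : Fin 2 → ℝ :=
  ![η 0 * η 1, (1 - η 0) * (1 + η 1) / (2 * (1 - η 0 * η 1))]

/-- The open unit box in `ℝ²`, token for token as in the stubs. -/
def box : Set (Fin 2 → ℝ) := {z | ∀ i, z i ∈ Ioo (0:ℝ) 1}

theorem mem_box {z : Fin 2 → ℝ} : z ∈ box ↔ (0 < z 0 ∧ z 0 < 1) ∧ (0 < z 1 ∧ z 1 < 1) := by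
  simp [box, Fin.forall_fin_two, mem_Ioo]

@[simp] theorem phi_apply_zero (η : Fin 2 → ℝ) : phi η 0 = η 0 * η 1 := rfl

@[simp] theorem phi_apply_one (η : Fin 2 → ℝ) :
    phi η 1 = (1 - η 0) * (1 + η 1) / (2 * (1 - η 0 * η 1)) := rfl

/-- `ξ₁ − 1/2 = (η₁ − η₀) / (2(1 − η₀η₁))`: the chamber `η₀ < η₁` goes to `ξ₁ > 1/2`, the diagonal to
`ξ₁ = 1/2`. -/
theorem phi_one_sub_half (η : Fin 2 → ℝ) (h : η 0 * η 1 ≠ 1) :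
    phi η 1 - 1 / 2 = (η 1 - η 0) / (2 * (1 - η 0 * η 1)) := by
  have h' : (1 - η 0 * η 1) ≠ 0 := sub_ne_zero.mpr (Ne.symm h)
  rw [phi_apply_one]
  field_simp
  ring

/-- The level identity behind the pullback: `4(1−ξ₀)²ξ₁(1−ξ₁) = (1−η₀²)(1−η₁²)` for `ξ = Φ η`. -/
theorem phi_level (η : Fin 2 → ℝ) (h : η 0 * η 1 ≠ 1) :
    4 * (1 - phi η 0) ^ 2 * (phi η 1) * (1 - phi η 1) = (1 - η 0 ^ 2) * (1 - η 1 ^ 2) := by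
  have h' : (1 - η 0 * η 1) ≠ 0 := sub_ne_zero.mpr (Ne.symm h)
  rw [phi_apply_zero, phi_apply_one]
  field_simp
  ring

/-- `Φ` maps the open box into the open box. -/
theorem phi_mapsTo : MapsTo phi box box := by
  intro η hη
  rw [mem_box] at hη ⊢
  obtain ⟨⟨h0, h0'⟩, ⟨h1, h1'⟩⟩ := hη
  have hP : η 0 * η 1 < 1 := by nlinarith
  have hD : 0 < 2 * (1 - η 0 * η 1) := by nlinarith
  refine ⟨⟨?_, ?_⟩, ?_, ?_⟩
  · rw [phi_apply_zero]; positivity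
  · rw [phi_apply_zero]; exact hP
  · rw [phi_apply_one]
    apply div_pos _ hD
    nlinarith
  · rw [phi_apply_one, div_lt_one hD]
    nlinarith

/-- `Φ` is injective on the open box (card's cheapest falsifier (iii): a failure of `InjOn` would
have been unrepairable — it holds). -/
theorem phi_injOn : InjOn phi box := by
  intro η hη η' hη' heq
  rw [mem_box] at hη hη'
  obtain ⟨⟨h0, h0'⟩, ⟨h1, h1'⟩⟩ := hη
  obtain ⟨⟨g0, g0'⟩, ⟨g1, g1'⟩⟩ := hη'
  have hP : η 0 * η 1 < 1 := by nlinarith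
  have hP' : η' 0 * η' 1 < 1 := by nlinarith
  have e0 : η 0 * η 1 = η' 0 * η' 1 := by
    have := congr_fun heq 0
    simpa using this
  have e1 : (1 - η 0) * (1 + η 1) = (1 - η' 0) * (1 + η' 1) := by
    have h := congr_fun heq 1
    simp only [phi_apply_one] at h
    rw [e0] at h
    have hD : (2 * (1 - η' 0 * η' 1)) ≠ 0 := by nlinarith
    rw [div_eq_div_iff hD hD] at h
    exact mul_right_cancel₀ hD h
  -- differences agree
  have ed : η 1 - η 0 = η' 1 - η' 0 := by nlinarith
  -- products and differences determine the positive pair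
  have key : (η 0 - η' 0) * (η 0 + η' 1) = 0 := by nlinarith
  have hpos : η 0 + η' 1 ≠ 0 := by nlinarith
  have h00 : η 0 = η' 0 := by
    have := mul_eq_zero.mp key
    rcases this with h | h
    · linarith
    · exact absurd h hpos
  have h11 : η 1 = η' 1 := by linarith
  funext i
  fin_cases i
  · exact h00
  · exact h11

/-- `Φ` maps the open box ONTO the open box: explicit inverse `d = (2ξ₁−1)(1−ξ₀)`,
`η₀ = (−d + √(d²+4ξ₀))/2`, `η₁ = η₀ + d`. -/
theorem phi_surjOn : SurjOn phi box box := by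
  intro ξ hξ
  rw [mem_box] at hξ
  obtain ⟨⟨k0, k0'⟩, ⟨k1, k1'⟩⟩ := hξ
  set d : ℝ := (2 * ξ 1 - 1) * (1 - ξ 0) with hd
  set R : ℝ := Real.sqrt (d ^ 2 + 4 * ξ 0) with hR
  have hrad : 0 ≤ d ^ 2 + 4 * ξ 0 := by positivity
  have hR2 : R ^ 2 = d ^ 2 + 4 * ξ 0 := Real.sq_sqrt hrad
  have hR0 : 0 ≤ R := Real.sqrt_nonneg _
  -- |d| < 1 - ξ 0
  have hd1 : d < 1 - ξ 0 := by
    rw [hd]; nlinarith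
  have hd2 : -d < 1 - ξ 0 := by
    rw [hd]; nlinarith
  -- R > |d|
  have hRd : |d| < R := by
    rw [hR, Real.lt_sqrt (abs_nonneg d), sq_abs]
    linarith
  have hRd1 : d < R := lt_of_le_of_lt (le_abs_self d) hRd
  have hRd2 : -d < R := lt_of_le_of_lt (neg_le_abs d) hRd
  -- R < 2 + d and R < 2 - d
  have hRu1 : R < 2 + d := by
    rw [hR, Real.sqrt_lt' (by linarith)]
    nlinarith
  have hRu2 : R < 2 - d := by
    rw [hR, Real.sqrt_lt' (by linarith)]
    nlinarith
  refine ⟨![(-d + R) / 2, (d + R) / 2], ?_, ?_⟩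
  · rw [mem_box]
    simp only [Matrix.cons_val_zero, Matrix.cons_val_one]
    refine ⟨⟨by linarith, by linarith⟩, by linarith, by linarith⟩
  · have hprod : (-d + R) / 2 * ((d + R) / 2) = ξ 0 := by nlinarith
    funext i
    fin_cases i
    · simp [phi, hprod]
    · simp only [phi, Fin.mk_one, Matrix.cons_val_one, Matrix.cons_val_zero]
      rw [hprod]
      have hD : (2 * (1 - ξ 0)) ≠ 0 := by nlinarith
      rw [div_eq_iff hD]
      nlinarith

/-- The image of the open box under `Φ` is the open box (the `r'.domain = Φ '' r.domain` side
condition of `changeOfVariablesRel` for `stub_dupPhi`). -/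
theorem phi_image_box : phi '' box = box :=
  phi_surjOn.image_eq_of_mapsTo phi_mapsTo

/-- `Φ` restricts to a bijection of the open box. -/
theorem phi_bijOn : BijOn phi box box := ⟨phi_mapsTo, phi_injOn, phi_surjOn⟩


/-! ## Derivative and Jacobian determinant of `Φ` -/

open Matrix

/-- The Jacobian matrix of `Φ` at `η` (rows = components of `Φ`, columns = `∂/∂η₀, ∂/∂η₁`). -/
def jac (η : Fin 2 → ℝ) : Matrix (Fin 2) (Fin 2) ℝ :=
  !![η 1, η 0;
     -(1 - η 1 ^ 2) / (2 * (1 - η 0 * η 1) ^ 2), (1 - η 0 ^ 2) / (2 * (1 - η 0 * η 1) ^ 2)]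

/-- The derivative of `Φ` at `η` as a continuous linear map. -/
def phiDeriv (η : Fin 2 → ℝ) : (Fin 2 → ℝ) →L[ℝ] (Fin 2 → ℝ) :=
  LinearMap.toContinuousLinearMap (Matrix.toLin' (jac η))

theorem phiDeriv_apply (η v : Fin 2 → ℝ) : phiDeriv η v = (jac η).mulVec v := by
  simp [phiDeriv]

theorem phiDeriv_apply_zero (η v : Fin 2 → ℝ) : phiDeriv η v 0 = η 1 * v 0 + η 0 * v 1 := by
  rw [phiDeriv_apply]
  simp [jac, Matrix.mulVec, dotProduct, Fin.sum_univ_two]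

theorem phiDeriv_apply_one (η v : Fin 2 → ℝ) :
    phiDeriv η v 1 = -(1 - η 1 ^ 2) / (2 * (1 - η 0 * η 1) ^ 2) * v 0 +
      (1 - η 0 ^ 2) / (2 * (1 - η 0 * η 1) ^ 2) * v 1 := by
  rw [phiDeriv_apply]
  simp [jac, Matrix.mulVec, dotProduct, Fin.sum_univ_two]

theorem det_jac (η : Fin 2 → ℝ) (h : η 0 * η 1 ≠ 1) :
    (jac η).det = (η 0 + η 1) / (2 * (1 - η 0 * η 1)) := by
  have h' : (1 - η 0 * η 1) ≠ 0 := sub_ne_zero.mpr (Ne.symm h)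
  have h2 : (2 * (1 - η 0 * η 1) ^ 2) ≠ 0 := by positivity
  have h3 : (2 * (1 - η 0 * η 1)) ≠ 0 := by positivity
  rw [jac, Matrix.det_fin_two_of]
  have key : η 1 * ((1 - η 0 ^ 2) / (2 * (1 - η 0 * η 1) ^ 2)) -
      η 0 * (-(1 - η 1 ^ 2) / (2 * (1 - η 0 * η 1) ^ 2)) =
      ((η 0 + η 1) * (1 - η 0 * η 1)) / (2 * (1 - η 0 * η 1) ^ 2) := by
    ring
  rw [key, div_eq_div_iff h2 h3]
  ring

/-- `det Φ'(η) = (η₀ + η₁) / (2(1 − η₀η₁))`. -/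
theorem det_phiDeriv (η : Fin 2 → ℝ) (h : η 0 * η 1 ≠ 1) :
    (phiDeriv η).det = (η 0 + η 1) / (2 * (1 - η 0 * η 1)) := by
  have hdet : (phiDeriv η).det = (jac η).det := by
    change LinearMap.det ((phiDeriv η : (Fin 2 → ℝ) →L[ℝ] (Fin 2 → ℝ)) :
      (Fin 2 → ℝ) →ₗ[ℝ] (Fin 2 → ℝ)) = _
    have : ((phiDeriv η : (Fin 2 → ℝ) →L[ℝ] (Fin 2 → ℝ)) : (Fin 2 → ℝ) →ₗ[ℝ] (Fin 2 → ℝ)) =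
        Matrix.toLin' (jac η) := by
      refine LinearMap.ext fun v => ?_
      simp [phiDeriv]
    rw [this, LinearMap.det_toLin']
  rw [hdet, det_jac η h]

/-- Coordinate projections as continuous linear maps `ℝ² → ℝ`. -/
abbrev π (i : Fin 2) : (Fin 2 → ℝ) →L[ℝ] ℝ := ContinuousLinearMap.proj i

theorem hasFDerivAt_coord (i : Fin 2) (η : Fin 2 → ℝ) :
    HasFDerivAt (fun y : Fin 2 → ℝ => y i) (π i) η :=
  hasFDerivAt_apply (𝕜 := ℝ) i η

theorem hasFDerivAt_prod01 (η : Fin 2 → ℝ) :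
    HasFDerivAt (fun y : Fin 2 → ℝ => y 0 * y 1) (η 0 • π 1 + η 1 • π 0) η :=
  (hasFDerivAt_coord 0 η).mul (hasFDerivAt_coord 1 η)

theorem hasFDerivAt_num (η : Fin 2 → ℝ) :
    HasFDerivAt (fun y : Fin 2 → ℝ => (1 - y 0) * (1 + y 1))
      ((1 - η 0) • π 1 + (1 + η 1) • (-π 0)) η := by
  have a : HasFDerivAt (fun y : Fin 2 → ℝ => 1 - y 0) (-π 0) η :=
    (hasFDerivAt_coord 0 η).const_sub 1
  have b : HasFDerivAt (fun y : Fin 2 → ℝ => 1 + y 1) (π 1) η :=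
    (hasFDerivAt_coord 1 η).const_add 1
  exact a.mul b

theorem hasFDerivAt_den (η : Fin 2 → ℝ) :
    HasFDerivAt (fun y : Fin 2 → ℝ => 2 * (1 - y 0 * y 1))
      ((2:ℝ) • -(η 0 • π 1 + η 1 • π 0)) η :=
  ((hasFDerivAt_prod01 η).const_sub 1).const_mul (2:ℝ)

theorem hasFDerivAt_denInv (η : Fin 2 → ℝ) (hD : (2 * (1 - η 0 * η 1)) ≠ 0) :
    HasFDerivAt (fun y : Fin 2 → ℝ => (2 * (1 - y 0 * y 1))⁻¹)
      ((-((2 * (1 - η 0 * η 1)) ^ 2)⁻¹) • ((2:ℝ) • -(η 0 • π 1 + η 1 • π 0))) η :=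
  (hasDerivAt_inv hD).comp_hasFDerivAt η (hasFDerivAt_den η)

theorem hasFDerivAt_row1 (η : Fin 2 → ℝ) (hD : (2 * (1 - η 0 * η 1)) ≠ 0) :
    HasFDerivAt (fun y : Fin 2 → ℝ => (1 - y 0) * (1 + y 1) * (2 * (1 - y 0 * y 1))⁻¹)
      (((1 - η 0) * (1 + η 1)) • ((-((2 * (1 - η 0 * η 1)) ^ 2)⁻¹) •
          ((2:ℝ) • -(η 0 • π 1 + η 1 • π 0))) +
        (2 * (1 - η 0 * η 1))⁻¹ • ((1 - η 0) • π 1 + (1 + η 1) • (-π 0))) η :=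
  (hasFDerivAt_num η).mul (hasFDerivAt_denInv η hD)

/-- `Φ` has derivative `phiDeriv η` at every `η` with `η₀η₁ ≠ 1` (in particular on the open box). -/
theorem hasFDerivAt_phi (η : Fin 2 → ℝ) (h : η 0 * η 1 ≠ 1) :
    HasFDerivAt phi (phiDeriv η) η := by
  have h' : (1 - η 0 * η 1) ≠ 0 := sub_ne_zero.mpr (Ne.symm h)
  have hD : (2 * (1 - η 0 * η 1)) ≠ 0 := mul_ne_zero two_ne_zero h'
  refine hasFDerivAt_pi'' fun i => ?_
  fin_cases i
  · -- row 0
    have hL : (ContinuousLinearMap.proj 0).comp (phiDeriv η) = η 0 • π 1 + η 1 • π 0 := by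
      refine ContinuousLinearMap.ext fun v => ?_
      simp only [ContinuousLinearMap.coe_comp, Function.comp_apply, ContinuousLinearMap.proj_apply,
        phiDeriv_apply_zero, _root_.add_apply, FunLike.coe_smul, Pi.smul_apply, smul_eq_mul]
      ring
    have hf : (fun y : Fin 2 → ℝ => phi y 0) = fun y => y 0 * y 1 := by
      funext y; simp [phi]
    simp only [Fin.zero_eta]
    rw [hL, hf]
    exact hasFDerivAt_prod01 η
  · -- row 1
    have hf : (fun y : Fin 2 → ℝ => phi y 1) =
        fun y => (1 - y 0) * (1 + y 1) * (2 * (1 - y 0 * y 1))⁻¹ := by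
      funext y; simp [phi, div_eq_mul_inv]
    have hL : (ContinuousLinearMap.proj 1).comp (phiDeriv η) =
        ((1 - η 0) * (1 + η 1)) • ((-((2 * (1 - η 0 * η 1)) ^ 2)⁻¹) •
            ((2:ℝ) • -(η 0 • π 1 + η 1 • π 0))) +
          (2 * (1 - η 0 * η 1))⁻¹ • ((1 - η 0) • π 1 + (1 + η 1) • (-π 0)) := by
      refine ContinuousLinearMap.ext fun v => ?_
      simp only [ContinuousLinearMap.coe_comp, Function.comp_apply, ContinuousLinearMap.proj_apply,
        phiDeriv_apply_one, _root_.add_apply, FunLike.coe_smul, Pi.smul_apply, smul_eq_mul,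
        _root_.neg_apply]
      field_simp
      ring
    simp only [Fin.mk_one]
    rw [hL, hf]
    exact hasFDerivAt_row1 η hD


/-- The Jacobian determinant is positive on the open box. -/
theorem det_phiDeriv_pos {η : Fin 2 → ℝ} (hη : η ∈ box) : 0 < (phiDeriv η).det := by
  rw [mem_box] at hη
  obtain ⟨⟨h0, h0'⟩, ⟨h1, h1'⟩⟩ := hη
  have hP : η 0 * η 1 < 1 := by nlinarith
  rw [det_phiDeriv η hP.ne]
  apply div_pos <;> nlinarith

/-- On the open box, `Φ` has derivative `phiDeriv η` within the box (the literal side condition). -/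
theorem hasFDerivWithinAt_phi {η : Fin 2 → ℝ} (hη : η ∈ box) :
    HasFDerivWithinAt phi (phiDeriv η) box η := by
  rw [mem_box] at hη
  obtain ⟨⟨h0, h0'⟩, ⟨h1, h1'⟩⟩ := hη
  have hP : η 0 * η 1 < 1 := by nlinarith
  exact (hasFDerivAt_phi η hP.ne).hasFDerivWithinAt

end Drefute.Phi
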